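import Mathlib
import Summits.Ventures.PercRepro2.Defs
import Summits.Ventures.PercRepro2.Graph
import Summits.Ventures.PercRepro2.Harris
import Summits.Ventures.PercRepro2.Events
import Summits.Ventures.PercRepro2.Independence
import Summits.Ventures.PercRepro2.Induced
import Summits.Ventures.PercRepro2.Exploration
import Summits.Ventures.PercRepro2.SideCluster
import Summits.Ventures.PercRepro2.WStatus
import Summits.Ventures.PercRepro2.WStatusLSM
import Summits.Ventures.PercRepro2.CactusDefs
import Summits.Ventures.PercRepro2.CactusTriangle
import Summits.Ventures.PercRepro2.CactusTriangleMass

/-!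
# The cluster law on a triangular cactus is log-supermodular (blind cell PercRepro2, mine-c g10;
proofs/MINEC-FEEDBACK.md §13)

Induction along the construction of the cactus from the root: the cluster law of `G[∅]` is the
point mass at `{s}`; along a pendant edge or a pendant triangle the law factorises into the old law
(composed with the lattice homomorphism `W ↦ W ∖ {new vertices}`) times a log-supermodular trace
law (`CactusDefs`, `CactusTriangle`), and products of log-supermodular functions are
log-supermodular. Hence:

**THEOREM** (`clusterLogSupermod_of_isCactusFrom`): if the edge set of `G` is a triangular cactus
built from the root `s`, the cluster law `W ↦ P(C(s) = W)` satisfies the FKG lattice condition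
`SideCluster.ClusterLogSupermod` — the triangular-cactus extension of
`ForestCluster.clusterLogSupermod_of_isForest` (g8). Consequently mine-1's W-inequality holds on
every triangular cactus (`wIneqStatus_of_isCactusFrom`, via `wIneqStatus_of_clusterLogSupermod`).
-/

namespace Summit.Ventures.PercRepro2

namespace Cactus

open scoped Classical

attribute [local instance 2000] Classical.propDecidable

variable {V : Type*} {E : Type*} [Fintype E] [Fintype V]
variable {R : Type*} [Field R] [LinearOrder R] [IsStrictOrderedRing R]

/-! ## The empty edge set -/

omit [Fintype E] [Fintype V] in
/-- With every edge closed the cluster of `s` is `{s}`. -/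
lemma clusterOn_empty (ends : E → Sym2 V) (ω : Config E) (s : V) :
    clusterOn ends ∅ ω s = {s} := by
  ext v
  simp only [clusterOn, mem_cluster, Set.mem_singleton_iff]
  constructor
  · intro h
    obtain ⟨q⟩ := h
    cases hq : q with
    | nil => rfl
    | cons hadj _ =>
      rw [openGraph_adj] at hadj
      obtain ⟨_, e, he, _⟩ := hadj
      exact absurd (restrict_eq_true_iff.1 he).2 (Set.notMem_empty e)
  · rintro rfl
    exact conn_refl _ _ _

omit [Fintype V] [LinearOrder R] [IsStrictOrderedRing R] in
/-- The cluster law of `G[∅]` is the point mass at `{s}`. -/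
lemma massOn_empty (p : E → R) (ends : E → Sym2 V) (s : V) (W : Finset V) :
    massOn p ends ∅ s W = if W = {s} then 1 else 0 := by
  unfold massOn
  simp only [clusterOn_empty]
  split_ifs with h
  · rw [show {ω : Config E | ({s} : Set V) = ↑W} = Set.univ from ?_, prob_univ]
    ext ω
    simp [h]
  · rw [show {ω : Config E | ({s} : Set V) = ↑W} = ∅ from ?_, prob_empty]
    ext ω
    simp only [Set.mem_setOf_eq, Set.mem_empty_iff_false, iff_false]
    intro h'
    apply h
    ext v
    have := congrArg (fun S : Set V => v ∈ S) h'
    simpa using this.symm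

/-! ## Composition -/

omit [Fintype E] [Fintype V] in
/-- Erasing a vertex commutes with intersections. -/
lemma erase_inter_distrib' (W₁ W₂ : Finset V) (a : V) :
    (W₁ ∩ W₂).erase a = W₁.erase a ∩ W₂.erase a := by
  ext v
  simp only [Finset.mem_erase, Finset.mem_inter]
  tauto

omit [Fintype E] [Fintype V] in
/-- Products of log-supermodular functions are log-supermodular. -/
lemma lsm_mul {a₁ a₂ a₃ a₄ g₁ g₂ g₃ g₄ : R} (ha : a₁ * a₂ ≤ a₃ * a₄) (hg : g₁ * g₂ ≤ g₃ * g₄)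
    (ha0 : 0 ≤ a₃ * a₄) (hg0 : 0 ≤ g₁ * g₂) :
    a₁ * g₁ * (a₂ * g₂) ≤ a₃ * g₃ * (a₄ * g₄) := by
  calc a₁ * g₁ * (a₂ * g₂) = (a₁ * a₂) * (g₁ * g₂) := by ring
    _ ≤ (a₃ * a₄) * (g₃ * g₄) := mul_le_mul ha hg hg0 ha0
    _ = a₃ * g₃ * (a₄ * g₄) := by ring

omit [Fintype E] [Fintype V] in
/-- The trace law of a pendant edge is nonnegative. -/
lemma gEdge_nonneg {p : E → R} (hp : IsProbVec p) (e : E) (x y : V) (W : Finset V) :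
    0 ≤ gEdge p e x y W := by
  have h0 := hp.nonneg e
  have h1 := hp.le_one e
  unfold gEdge gBool
  split_ifs <;> linarith

omit [Fintype E] [Fintype V] in
/-- The trace law of a pendant triangle is nonnegative. -/
lemma gTri_nonneg {p : E → R} (hp : IsProbVec p) (e₁ e₂ e₃ : E) (x y z : V) (W : Finset V) :
    0 ≤ gTri p e₁ e₂ e₃ x y z W :=
  gTriBool_nonneg (hp.nonneg e₁) (hp.le_one e₁) (hp.nonneg e₂) (hp.le_one e₂) (hp.nonneg e₃)
    (hp.le_one e₃) _ _ _

/-! ## The induction -/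

omit [Fintype V] in
/-- **The cluster law of `G[F]` is log-supermodular for every triangular cactus `F` from `s`.** -/
theorem massOn_lsm {p : E → R} (hp : IsProbVec p) {ends : E → Sym2 V} {s : V} {F : Set E}
    (h : IsCactusFrom ends s F) (W₁ W₂ : Finset V) :
    massOn p ends F s W₁ * massOn p ends F s W₂ ≤
      massOn p ends F s (W₁ ∩ W₂) * massOn p ends F s (W₁ ∪ W₂) := by
  induction h generalizing W₁ W₂ with
  | empty =>
    simp only [massOn_empty]
    by_cases h₁ : W₁ = {s} <;> by_cases h₂ : W₂ = {s}
    · subst h₁; subst h₂; simp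
    · rw [if_pos h₁, if_neg h₂, mul_zero]
      exact mul_nonneg (by split_ifs <;> norm_num) (by split_ifs <;> norm_num)
    · rw [if_neg h₁, zero_mul]
      exact mul_nonneg (by split_ifs <;> norm_num) (by split_ifs <;> norm_num)
    · rw [if_neg h₁, zero_mul]
      exact mul_nonneg (by split_ifs <;> norm_num) (by split_ifs <;> norm_num)
  | @edge F _ e x y he hxy hys hy heF ih =>
    rw [massOn_insert_edge p he hxy hys hy heF, massOn_insert_edge p he hxy hys hy heF,
      massOn_insert_edge p he hxy hys hy heF, massOn_insert_edge p he hxy hys hy heF,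
      erase_inter_distrib', Finset.erase_union_distrib]
    exact lsm_mul (ih _ _) (gEdge_lsm hp e x y W₁ W₂)
      (mul_nonneg (prob_nonneg hp _) (prob_nonneg hp _))
      (mul_nonneg (gEdge_nonneg hp e x y W₁) (gEdge_nonneg hp e x y W₂))
  | @triangle F _ e₁ e₂ e₃ x y z h₁ h₂ h₃ hxy hxz hyz hys hzs hy hz h₁₂ h₁₃ h₂₃ hn₁ hn₂ hn₃ ih =>
    rw [massOn_insert_triangle p h₁ h₂ h₃ hxy hxz hyz hys hzs hy hz h₁₂ h₁₃ h₂₃ hn₁ hn₂ hn₃,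
      massOn_insert_triangle p h₁ h₂ h₃ hxy hxz hyz hys hzs hy hz h₁₂ h₁₃ h₂₃ hn₁ hn₂ hn₃,
      massOn_insert_triangle p h₁ h₂ h₃ hxy hxz hyz hys hzs hy hz h₁₂ h₁₃ h₂₃ hn₁ hn₂ hn₃,
      massOn_insert_triangle p h₁ h₂ h₃ hxy hxz hyz hys hzs hy hz h₁₂ h₁₃ h₂₃ hn₁ hn₂ hn₃,
      erase_inter_distrib', erase_inter_distrib', Finset.erase_union_distrib,
      Finset.erase_union_distrib]
    exact lsm_mul (ih _ _) (gTri_lsm hp e₁ e₂ e₃ x y z W₁ W₂)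
      (mul_nonneg (prob_nonneg hp _) (prob_nonneg hp _))
      (mul_nonneg (gTri_nonneg hp e₁ e₂ e₃ x y z W₁) (gTri_nonneg hp e₁ e₂ e₃ x y z W₂))

/-! ## The theorem -/

omit [Fintype V] [LinearOrder R] [IsStrictOrderedRing R] in
/-- The cluster law of `G[univ]` is the cluster law of `G`. -/
lemma massOn_univ (p : E → R) (ends : E → Sym2 V) (s : V) (W : Finset V) :
    massOn p ends Set.univ s W = clusterMass p ends s W := by
  unfold massOn clusterMass clusterOn clusterEvent
  congr 1
  ext ω
  have : restrict Set.univ ω = ω := by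
    funext e
    exact restrict_apply_of_mem (Set.mem_univ e)
  simp only [Set.mem_setOf_eq, this]

omit [Fintype V] in
/-- **THEOREM (the cluster law on a triangular cactus is log-supermodular).** If the edge set of
`G` is a triangular cactus built from the root `s`, the cluster law `W ↦ P(C(s) = W)` satisfies
the FKG lattice condition on `Finset V`. -/
theorem clusterLogSupermod_of_isCactusFrom {p : E → R} (hp : IsProbVec p) {ends : E → Sym2 V}
    {s : V} (h : IsCactusFrom ends s Set.univ) : ClusterLogSupermod p ends s := by
  intro W₁ W₂
  rw [← massOn_univ, ← massOn_univ, ← massOn_univ, ← massOn_univ]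
  exact massOn_lsm hp h W₁ W₂

/-- **The W-inequality on every triangular cactus** (mine-1's conjecture of record `WRow`, via
`wIneqStatus_of_clusterLogSupermod`). -/
theorem wIneqStatus_of_isCactusFrom {p : E → R} (hp : IsProbVec p) {ends : E → Sym2 V} {s : V}
    (h : IsCactusFrom ends s Set.univ) (T F : Finset V) : WIneqStatus p ends s T F :=
  wIneqStatus_of_clusterLogSupermod ends s T F hp (clusterLogSupermod_of_isCactusFrom hp h)

end Cactus

end Summit.Ventures.PercRepro2
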